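import Summits.AtomisticToContinuum.FouriersLaw.Theses.HoelderEscapeProfile
import Summits.AtomisticToContinuum.FouriersLaw.Theorems.HoelderEscapeProfileFibreCalculus
import Summits.AtomisticToContinuum.FouriersLaw.Theorems.HoelderEscapeProfileAbelSpreadCeilingCanonicalTwin
import Summits.AtomisticToContinuum.FouriersLaw.Theorems.EmbeddedDrudeMourreAbelThermodynamicLimitFixedFrequencyMatching
import Summits.AtomisticToContinuum.FouriersLaw.Theorems.EmbeddedDrudeMourreAbelThermodynamicLimitRegularDLRUnique
import Summits.AtomisticToContinuum.FouriersLaw.Theorems.EmbeddedDrudeMourreAbelThermodynamicLimitOfLowerBound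
import Summits.AtomisticToContinuum.FouriersLaw.Theorems.OddSectorIrreversibilityCorrectorTheoryExistence
import Literature.MathematicalPhysics.KineticTheory.InfiniteChainShiftInvariantUniqueness

/-!
# Line `regularity-collapse` (`Lines/regularity-collapse.lean`) for crux `HoelderEscapeProfile.AbelSpreadCeiling`
(item `stmt-AtomisticToContinuum-16010`, route `route-AtomisticToContinuum-HoelderEscapeProfile`, crux rank 4;
sub-problem `FouriersLaw`; strategist `planner-cstrat-stmt-AtomisticToContinuum-16010-b1-0`, 2026-08-17;
the `--alt` to `Lines/birth.lean`; RESHAPED by the line lead `prover-line-stmt-AtomisticToContinuum-16010-0`,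
2026-08-17, cycle 1 — see "Reshape (lead, cycle 1)" below)

Crux (FIXED, concluded BY NAME below): for the infinite pinned chain `pinnedChain ω₂ lam β γ`
(`ω₂, lam, β > 0`, ANY bath constant `γ`) at `T > 0` and every guarded pair `(μ, D)` (shift- and
momentum-reversal-invariant DLR state `μ`, `μ`-preserving a.e. shift-covariant `InfiniteChainDynamics D`), the
ABEL ESCAPE PROFILE `S̄_ν(x) = ν∫₀^∞e^{-νt} Cov(h_0, h_x∘φ_t) dt` has `Σ_x x² S̄_ν(x) ≤ B/ν` for `0 < ν ≤ ν₀`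
— by Helfand–Abel, boundedness of the Abel Green–Kubo means `Â(ν) = ∫₀^∞ e^{-νt} C_T(t) dt` as `ν ↓ 0`.

## The line — THE CEILING IS THE ROUTE'S OWN (R)

The route ALREADY owes `UniformAbelianRegularity` (R) (item stmt-AtomisticToContinuum-13416): it is the core child
of the gen-1 split of `AbelThermodynamicLimit`, consumed by `closes` through the landed glue
`stub_cruxOfRegularityOfLowerBound`. (R) — `|∫₀^∞ (1 − e^{−νt}) c_N| ≤ εN` eventually in `N`, uniformly in small `ν`,
for the open chain's equilibrium total-current autocorrelation `c_N` — says that the open-chain Green–Kubo integral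
`∫₀^∞ c_N = (N−1)T² D_N` (Kundu–Dhar–Narayan, LANDED `openChainGreenKubo_holds`) and its Abel regularisation
`F_N(ν) = ∫₀^∞ e^{−νt} c_N` differ by `o(N)`.  At ONE fixed frequency `ν₁ < ν₀` the LANDED fixed-frequency matching
(`LoomisCompactHorizonWitness.stub_fixedFrequencyMatching`, for Buttà–Marchioro-regular pairs) gives
`F_N(ν₁)/N → Â(ν₁) ∈ ℝ`, hence `|∫₀^∞ c_N| ≤ (|Â(ν₁)| + 2)N`, hence `F_N(ν) ≤ (|Â(ν₁)| + 3)N` for EVERY `ν < ν₀`,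
hence `Â(ν) ≤ |Â(ν₁)| + 3`: the Abel means are bounded, with NO further dynamical input. The finiteness content of
`AbelSpreadCeiling` therefore sits entirely inside (R) (its docstring says so: "This IS the finiteness content"),
and the crux should not be staffed for its dynamics separately from (R); what remains is infrastructure:

* `stub_uniformAbelianRegularity` (THE CONTENT, open; VERBATIM item stmt-AtomisticToContinuum-13416, shared with
  CoercivePulse / EmbeddedDrudeMourre / StaticAbelianSqueeze; equivalent over landed theorems to the existence of the
  common limit `Â(ν) → L ← T²D_N`, `stub_regularityIffCommonLimit`).  Used at bath constant `γ' = 1`: the infinite-volume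
  objects of the crux do not see `γ` (`transportDyn`, definitional), so the crux's "any `γ`" costs nothing.
* CLOSED infrastructure (all LANDED through the gate, used BY NAME below or superseded): the canonical twin
  `Theorems.AbelSpreadCeiling.RegularityCollapse.stub_canonicalTwin` (every guarded dynamics IS the canonical
  Buttà–Marchioro dynamics `μ`-a.e. at all times; p158635) and the Helfand–Abel identity, which is clause (12) of the
  route item `HoelderEscapeProfile.FibreCalculus` (stmt-AtomisticToContinuum-16011), PROVED 2026-08-17T12:41Z
  (`Theorems.FibreCalculusSketch.fibreCalculus_proof`). The lead's own cut of clause (12) — stubs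
  `stub_fixedTimeRegularity` (p159920), `stub_perSiteHelfand` (p161942), `stub_abelExchange` (+Toolkit; p161412,
  p161609) — landed as `--supports` files and is superseded as skeleton input; `stub_currentL1Laplace` is dropped.
* COMPOSITION `AbelSpreadCeiling_of` (this file, no `sorry`): `abel_bound_of_regularity` (pure real analysis: the
  two triangle inequalities above) fed with the landed `nessUnique_proof`, `exists_steadyFamily_response`,
  `openChainGreenKubo_holds` (integrability of `c_N`, `N ≥ 2`), `integral_totalBondCurrent_gibbsMeasure` (`⟨J⟩ = 0`),
  `stub_regularDLRUnique` + `stub_fixedFrequencyMatching` applied to the twin transported to `γ' = 1`, then Helfand–Abel: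
  `Σ_x x²S̄_ν ≤ (2(|Â(ν₁)|+3) + |M₀|)/ν` for `0 < ν ≤ min(ν₀/2, 1)`.

## Reshape history (lead, cycle 1)
v1 (strategist): stubs (R) / `stub_guardedDynamicsRegular` (twin with an absolute-convergence hypothesis) /
`stub_fibreCalculus` (item stmt-16011 VERBATIM, 12 clauses, consumed only through clauses (1) and (12)).
v2–v3 (lead, 11:47Z–11:58Z): twin strengthened to the canonical normal form without hypothesis (landed p158635, with the
corollary `hasAbsConvergentCorrelation_of_preservesMeasure` = clause (1) for every guarded pair); clause (12) cut into
fixed-time regularity / per-site conservation law / ℓ¹-Laplace light cone / dynamics-free exchange, glued by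
`helfandAbel_of_stubs`; three of the four landed in wave 1 (p159920, p161942, p161609).
v4 (lead, 13:3xZ, THIS FILE): FibreCalculus itself landed (12:41Z), so clause (12) is taken from `fibreCalculus_proof` and
the skeleton has exactly ONE open stub, (R) = item stmt-AtomisticToContinuum-13416: `AbelSpreadCeiling_of :
Registered.stub_uniformAbelianRegularity → AbelSpreadCeiling`, everything else kernel-checked. The same term is landed
unfolded as `Theorems/HoelderEscapeProfileAbelSpreadCeilingOfUniformAbelianRegularity.lean` for the tenure planner
(`route edit --split AbelSpreadCeiling --into UniformAbelianRegularity --glue-by …`, or close-on-close).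

Corollary of the same composition (not needed here, recorded for the tenure planner): (R) + twin + FibreCalculus also
give `AbelRegularity` (stmt-15384; the Abel means converge), so in this route's cone the items AbelSpreadCeiling and
AbelRegularity are consequences of (R); the route's independent content is K1, K2 (positivity in infinite volume, the
alternative to `ConductanceLowerBound`), (R), FibreCalculus, SymmetricSetup and the twin lemma.

Hardest (and only open) stub: `stub_uniformAbelianRegularity` (open problem: BLR2000 §7; false at `lam = β = 0`, where
`∫₀^∞ c_N ~ N²`; staffed by its own crux chain `Cruxes/UniformAbelianRegularity/`, NOT refuted by its disprover).

## Disproof used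
None on file for this crux (payload `disproof_path` absent at 11:28Z and at 13:30Z; `ledger crux ls` shows no `Disproof.lean`).
Refuter crux-attack (NOTES.md of the crux dir): survives; its A6 (∀D over-generality) is neutralised by the landed twin. Negatives index: 20 entries; the FouriersLaw ones (OddCorrectorDecay stmt-9139, FarFieldGaussianity
stmt-12890) concern other objects; no stub is an instance of a refuted statement. Barriers honoured:
`HarmonicChainBallisticFlux` / `FixedLengthNoConductivityControl` — (R) is false for the harmonic member and is claimed only
for `lam, β > 0`; `SpectralGapClosing` — no `N`-uniform rate is used anywhere (fixed-frequency matching is rate-free).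
-/

noncomputable section

open MeasureTheory Filter Set
open scoped Topology BigOperators NNReal

namespace Summit.AtomisticToContinuum.FouriersLaw.Cruxes.AbelSpreadCeiling.RegularityCollapse

open Literature.MathematicalPhysics.KineticTheory.HeatConduction

/-! ### The registered stubs (`sorry` lives ONLY here) -/

/-- STUB 1 `stub_uniformAbelianRegularity` (the content, open; VERBATIM this route's item stmt-AtomisticToContinuum-13416,
the core residual (R) of the split `AbelThermodynamicLimit`) — `N`-UNIFORM ABELIAN REGULARITY of the open chain's
equilibrium total-current autocorrelation `c_N(t) = ∫ J · P_t J dμ_{N,T}`: for every `ε > 0` there is `ν₀ > 0` such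
that for all `ν ∈ (0, ν₀)`, eventually in `N`, `|∫₀^∞ (1 − e^{−νt}) c_N(t) dt| ≤ εN`.
[cite: BonettoLebowitzReyBellet2000, §7 eq. (37)] [cite: KunduDharNarayan2009, eqs. (8)–(15)] -/
theorem stub_uniformAbelianRegularity :
    ∀ ω₂ lam β γ : ℝ, 0 < ω₂ → 0 < lam → 0 < β → 0 < γ → ∀ T : ℝ, 0 < T → ∀ ε : ℝ, 0 < ε → ∃ ν₀ : ℝ, 0 < ν₀ ∧ ∀ ν : ℝ, 0 < ν → ν < ν₀ → ∃ N₀ : ℕ, ∀ N : ℕ, N₀ ≤ N → let J : PhaseSpace N → ℝ := fun z => ∑ i : Fin N, (pinnedChain ω₂ lam β γ).bondCurrent N i z; |∫ t in Set.Ioi (0:ℝ), (1 - Real.exp (-(ν * t))) * ∫ z, J z * (∫ y, J y ∂((pinnedChain ω₂ lam β γ).transitionKernel N T T t.toNNReal z)) ∂((pinnedChain ω₂ lam β γ).gibbsMeasure N T)| ≤ ε * N := by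
  sorry

/-! #### Closed stubs (landed through the gate; no `sorry`, nothing registered here any more)

* stub 2 `stub_canonicalTwin` — `Theorems/HoelderEscapeProfileAbelSpreadCeilingCanonicalTwin.lean` (p158635):
  `Theorems.AbelSpreadCeiling.RegularityCollapse.stub_canonicalTwin`, used BY NAME in the composition below.
* stubs 3, 4, 6 `stub_fixedTimeRegularity` / `stub_perSiteHelfand` / `stub_abelExchange` — landed as
  `…AbelSpreadCeilingFixedTimeRegularity.lean` (p159920), `…AbelSpreadCeilingPerSiteHelfand.lean` (p161942),
  `…AbelSpreadCeilingAbelExchangeToolkit.lean` + `…AbelSpreadCeilingAbelExchange.lean` (p161412, p161609). They were the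
  lead's cut of the Helfand–Abel identity; they are SUPERSEDED as skeleton inputs by the route item
  `HoelderEscapeProfile.FibreCalculus` (stmt-AtomisticToContinuum-16011), PROVED meanwhile
  (`Theorems.FibreCalculusSketch.fibreCalculus_proof`, 2026-08-17T12:41Z), whose clause (12) IS Helfand–Abel for every
  guarded pair; the composition now takes clause (12) from that theorem. Stub 5 `stub_currentL1Laplace` is dropped
  (no longer needed; it is a corollary of the window majorant `Σ_x(1+x²)(|S|+|G|) ≤ A(1+|t|)^m` inside that proof).
-/

/-! ### By-name statements of the registered stubs (pattern of `Lines/birth.lean`) -/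

namespace Registered

/-- Statement of registered stub 1 (`stub_uniformAbelianRegularity`), by name. -/
def stub_uniformAbelianRegularity : Prop := type_of% RegularityCollapse.stub_uniformAbelianRegularity

end Registered

/-! ### Infrastructure of the composition (no `sorry`) -/

/-- The bath constant `γ` is invisible to the infinite-volume dynamics: an `InfiniteChainDynamics` of
`pinnedChain ω₂ lam β γ` IS one of `pinnedChain ω₂ lam β γ'` (same `U`, `V`; all fields definitionally equal). [folklore] -/
def transportDyn {ω₂ lam β γ : ℝ} (γ' : ℝ) (D : InfiniteChainDynamics (pinnedChain ω₂ lam β γ)) :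
    InfiniteChainDynamics (pinnedChain ω₂ lam β γ') :=
  ⟨D.carrier, D.flow, D.mapsTo, D.flow_zero, D.isSolution, D.unique⟩

/-- **Abel splitting identity.** For `c` integrable on `(0,∞)` and `ν > 0`, `e^{−νt}c` is integrable there and
`∫₀^∞ (1 − e^{−νt}) c = ∫₀^∞ c − ∫₀^∞ e^{−νt} c`. [folklore] -/
theorem integral_one_sub_exp_mul (c : ℝ → ℝ) {ν : ℝ} (hν : 0 < ν) (hc : IntegrableOn c (Ioi 0)) :
    ∫ t in Ioi (0:ℝ), (1 - Real.exp (-(ν * t))) * c t =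
      (∫ t in Ioi (0:ℝ), c t) - ∫ t in Ioi (0:ℝ), Real.exp (-(ν * t)) * c t := by
  have hmeas : AEStronglyMeasurable (fun t : ℝ => Real.exp (-(ν * t))) (volume.restrict (Ioi 0)) :=
    (Real.continuous_exp.comp (continuous_const.mul continuous_id).neg).aestronglyMeasurable
  have hbound : ∀ᵐ t ∂(volume.restrict (Ioi (0:ℝ))), ‖Real.exp (-(ν * t))‖ ≤ 1 := by
    rw [ae_restrict_iff' measurableSet_Ioi]
    refine Eventually.of_forall fun t ht => ?_
    rw [Real.norm_eq_abs, abs_of_pos (Real.exp_pos _), Real.exp_le_one_iff]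
    have : 0 ≤ ν * t := mul_nonneg hν.le (le_of_lt ht)
    linarith
  have h1 : IntegrableOn (fun t => Real.exp (-(ν * t)) * c t) (Ioi 0) := hc.bdd_mul hmeas hbound
  have h2 : (fun t => (1 - Real.exp (-(ν * t))) * c t) = fun t => c t - Real.exp (-(ν * t)) * c t := by
    funext t; ring
  rw [h2, integral_sub hc h1]

/-- **Abel bound from regularity (pure real analysis; the heart of the collapse).** Let `c_N` be eventually
integrable on `(0,∞)`, `|∫₀^∞(1−e^{−νt})c_N| ≤ N` eventually in `N` for every `ν ∈ (0, ν₀)` ((R) with `ε = 1`), and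
let the normalised Abel mean at ONE frequency `ν₁ ∈ (0, ν₀)` converge, `(∫₀^∞e^{−ν₁t}c_N)/N → a₁`. Then for every
`ν ∈ (0, ν₀)`, eventually in `N`, `(∫₀^∞e^{−νt}c_N)/N ≤ |a₁| + 3` (`|∫c_N| ≤ (|a₁|+2)N` by the triangle inequality at
`ν₁`, then `∫e^{−νt}c_N ≤ |∫c_N| + N`). [folklore] -/
theorem abel_bound_of_regularity (c : ℕ → ℝ → ℝ) {ν₀ ν₁ a₁ : ℝ}
    (hint : ∀ᶠ N : ℕ in atTop, IntegrableOn (c N) (Ioi 0))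
    (hR : ∀ ν : ℝ, 0 < ν → ν < ν₀ → ∀ᶠ N : ℕ in atTop,
      |∫ t in Ioi (0:ℝ), (1 - Real.exp (-(ν * t))) * c N t| ≤ 1 * N)
    (hν₁ : 0 < ν₁) (hν₁' : ν₁ < ν₀)
    (hlim : Tendsto (fun N : ℕ => (∫ t in Ioi (0:ℝ), Real.exp (-(ν₁ * t)) * c N t) / (N : ℝ))
      atTop (𝓝 a₁)) :
    ∀ ν : ℝ, 0 < ν → ν < ν₀ → ∀ᶠ N : ℕ in atTop,
      (∫ t in Ioi (0:ℝ), Real.exp (-(ν * t)) * c N t) / (N : ℝ) ≤ |a₁| + 3 := by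
  intro ν hν hν'
  have hball : ∀ᶠ N : ℕ in atTop,
      dist ((∫ t in Ioi (0:ℝ), Real.exp (-(ν₁ * t)) * c N t) / (N : ℝ)) a₁ < 1 :=
    hlim (Metric.ball_mem_nhds a₁ one_pos)
  filter_upwards [hint, hR ν₁ hν₁ hν₁', hR ν hν hν', hball, eventually_ge_atTop 1] with N hcN hR₁ hRν hb h1N
  have hNpos : (0:ℝ) < N := by exact_mod_cast h1N
  rw [integral_one_sub_exp_mul (c N) hν₁ hcN] at hR₁
  rw [integral_one_sub_exp_mul (c N) hν hcN] at hRν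
  set F₁ := ∫ t in Ioi (0:ℝ), Real.exp (-(ν₁ * t)) * c N t with hF₁
  set F := ∫ t in Ioi (0:ℝ), Real.exp (-(ν * t)) * c N t with hF
  set I := ∫ t in Ioi (0:ℝ), c N t with hI
  rw [Real.dist_eq] at hb
  have hF₁b : |F₁| ≤ (|a₁| + 1) * N := by
    have e1 : |F₁ / N| < |a₁| + 1 := by
      have := abs_sub_abs_le_abs_sub (F₁ / N) a₁
      linarith
    rw [abs_div, abs_of_pos hNpos, div_lt_iff₀ hNpos] at e1
    linarith
  have hIb : |I| ≤ (|a₁| + 2) * N := by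
    have e := abs_sub_abs_le_abs_sub I F₁
    linarith
  have hFb : F ≤ (|a₁| + 3) * N := by
    have e1 := neg_abs_le (I - F)
    have e2 := le_abs_self I
    linarith
  rw [div_le_iff₀ hNpos]
  exact hFb

/-! ### The composition (kernel-checked, no `sorry`): the ONE open stub (R) gives the crux BY NAME -/

/-- `stub_uniformAbelianRegularity → AbelSpreadCeiling` — THE CEILING IS THE ROUTE'S OWN (R), over landed theorems.
At the crux's arena: the PROVED route item `FibreCalculus` (`fibreCalculus_proof`, clause (12)) gives the Helfand–Abel
identity; the LANDED twin (`Theorems.AbelSpreadCeiling.RegularityCollapse.stub_canonicalTwin`) the canonical BM-regular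
`D'` (absolutely convergent correlations) with the same `C_T`, transported to bath constant `1`; landed DLR uniqueness +
superstability + fixed-frequency matching give `F_N(ν)/N → Â(ν)` for every `ν > 0`; (R) at `ε = 1` and the landed
open-chain Green–Kubo identity feed `abel_bound_of_regularity` at `ν₁ = ν₀/2`, whence `Â(ν) ≤ |Â(ν₁)| + 3` for
`ν < ν₀`; Helfand–Abel turns this into `Σ_x x²S̄_ν ≤ (2(|Â(ν₁)|+3) + |M₀|)/ν` for `0 < ν ≤ min(ν₀/2, 1)`. [folklore] -/
theorem AbelSpreadCeiling_of (hRstub : Registered.stub_uniformAbelianRegularity) :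
    _root_.Summit.AtomisticToContinuum.FouriersLaw.Theses.HoelderEscapeProfile.AbelSpreadCeiling := by
  intro ω₂ lam β γ hω hl hβ T hT μ hG hSI hR D hP hSh h hh S hS Sb hSb _hInt _hSum
  set P₁ := pinnedChain ω₂ lam β 1 with hP₁
  -- Helfand–Abel = clause (12) of the PROVED route item FibreCalculus (stmt-AtomisticToContinuum-16011)
  obtain ⟨-, -, -, -, -, -, -, -, -, -, -, hHelf⟩ :=
    Summit.AtomisticToContinuum.FouriersLaw.Theorems.FibreCalculusSketch.fibreCalculus_proof ω₂ lam β γ hω hl hβ T hT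
      μ hG hSI hR D hP hSh h hh S hS Sb hSb _ rfl _ rfl _ rfl _ rfl
  -- the canonical BM twin (LANDED stub 2), transported to bath constant 1, and the landed matching
  obtain ⟨D', hcar, -, -, hP', -, hAC', hCC⟩ :=
    Summit.AtomisticToContinuum.FouriersLaw.Theorems.AbelSpreadCeiling.RegularityCollapse.stub_canonicalTwin
      ω₂ lam β γ hω hl hβ T hT μ hG hSI hR D hP
  let D₁ : InfiniteChainDynamics (pinnedChain ω₂ lam β 1) := transportDyn 1 D'
  have hG₁ : (pinnedChain ω₂ lam β 1).IsChainGibbsMeasure T μ := hG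
  have hSS₁ : (pinnedChain ω₂ lam β 1).HasSuperstabilityEstimate μ :=
    OscillatorChain.hasSuperstabilityEstimate_of_isShiftInvariant_pinnedChain 1 hω hl.le hβ.le hT hG₁ hSI
  have hcar₁ : D₁.carrier ⊆ (pinnedChain ω₂ lam β 1).bmGood := subset_of_eq hcar
  have hPres₁ : D₁.PreservesMeasure μ := hP'
  have hAC₁ : ∀ t : ℝ, D₁.HasAbsConvergentCorrelation μ t := hAC'
  have hUniq := Summit.AtomisticToContinuum.FouriersLaw.Theorems.AbelThermodynamicLimit.LoomisCompactHorizonWitness.stub_regularDLRUnique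
    ω₂ lam β 1 hω hl hβ one_pos T hT
  have hMatch := Summit.AtomisticToContinuum.FouriersLaw.Theorems.AbelThermodynamicLimit.LoomisCompactHorizonWitness.stub_fixedFrequencyMatching
    ω₂ lam β 1 hω hl hβ one_pos T hT hUniq μ D₁ hG₁ hSI hSS₁ hcar₁ hPres₁ hAC₁
  have hcc : ∀ t : ℝ, D₁.currentCorrelation μ t = D.currentCorrelation μ t := fun t => by
    rw [← hCC t]; rfl
  -- the open chain at bath constant 1: uniqueness, a steady family, integrability of c_N (landed KDN identity)
  have hUq := Summit.AtomisticToContinuum.FouriersLaw.Theorems.nessUnique_proof ω₂ lam β 1 hω hl hβ one_pos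
  obtain ⟨μc, Dc, hμc, -⟩ :=
    Summit.AtomisticToContinuum.FouriersLaw.Theorems.AbelThermodynamicLimit.LoomisCompactHorizonWitness.exists_steadyFamily_response
      ω₂ lam β 1 hω hl hβ one_pos hUq T hT
  let c : ℕ → ℝ → ℝ := fun N t => ∫ z, (∑ i : Fin N, P₁.bondCurrent N i z) *
      (∫ y, (∑ i : Fin N, P₁.bondCurrent N i y) ∂(P₁.transitionKernel N T T t.toNNReal z)) ∂(P₁.gibbsMeasure N T)
  have hint : ∀ᶠ N : ℕ in atTop, IntegrableOn (c N) (Ioi 0) := by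
    rw [eventually_atTop]
    refine ⟨2, fun N hN2 => ?_⟩
    have hGK := Summit.AtomisticToContinuum.FouriersLaw.Theorems.OddSectorIrreversibility.Corrector.openChainGreenKubo_holds
      ω₂ lam β 1 hω hl hβ one_pos hUq μc hμc T hT N hN2
    have hm0 := Summit.AtomisticToContinuum.FouriersLaw.Theorems.OddSectorIrreversibility.Corrector.integral_totalBondCurrent_gibbsMeasure
      ω₂ lam β 1 N T
    dsimp only at hGK
    rw [hm0, mul_zero] at hGK
    simp only [sub_zero] at hGK
    exact hGK.1
  -- (R) at bath constant 1 with ε = 1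
  obtain ⟨ν₀, hν₀, hRν⟩ := hRstub ω₂ lam β 1 hω hl hβ one_pos T hT 1 one_pos
  have hRev : ∀ ν : ℝ, 0 < ν → ν < ν₀ → ∀ᶠ N : ℕ in atTop,
      |∫ t in Ioi (0:ℝ), (1 - Real.exp (-(ν * t))) * c N t| ≤ 1 * N := by
    intro ν hν hν'
    obtain ⟨N₀, hN₀⟩ := hRν ν hν hν'
    rw [eventually_atTop]
    exact ⟨N₀, fun N hN => hN₀ N hN⟩
  -- the collapse: Â(ν) ≤ |Â(ν₁)| + 3 for ν < ν₀, ν₁ = ν₀/2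
  have hν₁ : 0 < ν₀ / 2 := by positivity
  have hν₁' : ν₀ / 2 < ν₀ := by linarith
  set a₁ : ℝ := MeasureTheory.integral (MeasureTheory.volume.restrict (Set.Ioi (0:ℝ)))
    (fun t : ℝ => Real.exp (-(ν₀ / 2 * t)) * D₁.currentCorrelation μ t) with ha₁
  have hkey := abel_bound_of_regularity c hint hRev hν₁ hν₁' (hMatch (ν₀ / 2) hν₁)
  set B₁ : ℝ := |a₁| + 3 with hB₁
  have hB₁0 : 0 ≤ B₁ := by positivity
  have hAbel : ∀ ν : ℝ, 0 < ν → ν < ν₀ →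
      ∫ t in Set.Ioi (0:ℝ), Real.exp (-(ν * t)) * D.currentCorrelation μ t ≤ B₁ := by
    intro ν hν hνlt
    have hle : MeasureTheory.integral (MeasureTheory.volume.restrict (Set.Ioi (0:ℝ)))
        (fun t : ℝ => Real.exp (-(ν * t)) * D₁.currentCorrelation μ t) ≤ B₁ :=
      le_of_tendsto (hMatch ν hν) (hkey ν hν hνlt)
    simpa only [hcc] using hle
  -- Helfand–Abel: the second moment of the Abel profile
  set M₀ : ℝ := ∑' x : ℤ, (x : ℝ) ^ 2 * S x 0 with hM₀
  refine ⟨2 * B₁ + |M₀|, min (ν₀ / 2) 1, lt_min hν₁ one_pos, fun ν hν hνle => ?_⟩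
  have hν1 : ν ≤ 1 := hνle.trans (min_le_right _ _)
  have hνlt : ν < ν₀ := lt_of_le_of_lt (hνle.trans (min_le_left _ _)) hν₁'
  have hb := hAbel ν hν hνlt
  rw [hHelf ν hν] at hb
  have hMν : (∑' x : ℤ, (x : ℝ) ^ 2 * Sb ν x) ≤ 2 * B₁ / ν + M₀ := by
    have e2 : (∑' x : ℤ, (x : ℝ) ^ 2 * Sb ν x) - M₀ ≤ 2 * B₁ / ν := by
      rw [le_div_iff₀ hν]; nlinarith
    linarith
  have hM₀ν : M₀ ≤ |M₀| / ν := by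
    rw [le_div_iff₀ hν]
    have := le_abs_self M₀
    nlinarith [abs_nonneg M₀]
  calc (∑' x : ℤ, (x : ℝ) ^ 2 * Sb ν x) ≤ 2 * B₁ / ν + M₀ := hMν
    _ ≤ 2 * B₁ / ν + |M₀| / ν := by linarith
    _ = (2 * B₁ + |M₀|) / ν := by ring

/-- Type-check (not a declaration): the sorried stubs are literally the antecedents of `AbelSpreadCeiling_of`. -/
example : _root_.Summit.AtomisticToContinuum.FouriersLaw.Theses.HoelderEscapeProfile.AbelSpreadCeiling :=
  AbelSpreadCeiling_of stub_uniformAbelianRegularity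

end Summit.AtomisticToContinuum.FouriersLaw.Cruxes.AbelSpreadCeiling.RegularityCollapse

end
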